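import Summits.Ventures.LatticeQCDFlow.Scoring.WilsonStapleSum
import Summits.Ventures.LatticeQCDFlow.Exactness.SU2StapleSum
import HarnessLib

/-!
# Cooling never increases the Wilson action — for every schedule — and on `SU(2)` the cooled link is `R_eᴴ/√det R_e`, the unique minimiser

HONEST FRAMING: exact (Metropolis-corrected) sampling algorithms for lattice gauge theory;
figures of merit are autocorrelation/cost numbers at stated couplings and volumes; no
continuum-physics claim.

Venture `LatticeQCDFlow` (cell pub-lqcd), sub-topic `Scoring`; FANOUT row 16 (`su2-base`).  The row's SECOND
topological-charge definition is the α-rounded clover charge measured after `n_cool` COOLING sweeps (the first is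
the clover charge after Wilson flow, `Scoring/WilsonFlowReflectionCovariance`); its acceptance test compares the two,
and its finding D1 (paired cooling, C site-major vs reference checkerboard order: energy after `n_cool = 5…20` sweeps
differs by `+13 % … +3 %`, the rounded charge agrees `10/10`, `39/40`) is about the dependence of cooling on the
VISITING ORDER.  This file types what does NOT depend on the order.  NEW WORK of the cell (placement rule), sequel
of `Scoring/WilsonStapleSum` (link action in staple form) over `TrivializingMaps/WilsonLinkLocality` (fibre lemmas,
`continuous_linkAction`) and `Exactness/SU2StapleSum` (quaternion algebra `IsQuat`, polar form `R = k ŝ`).  Nothing is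
cited as a fact; no number.  Printed counterparts, NAMED ONLY: Berg, Phys. Lett. B 104 (1981) 475 and Teper,
Phys. Lett. B 162 (1985) 357 (cooling = iterated local minimisation of the action); Hoek–Teper–Waterhouse,
Nucl. Phys. B 288 (1987) 589 (`SU(2)`: the minimising link is the normalised staple sum); Montvay–Münster (1994) §5.3.5.

## What is proved

§1 ANY compact gauge group `G`, any representation `ρ` (torus `(ℤ/L)^d`, `L ≥ 1`):
* `IsCoolingStep ρ e U U'` — `U'` agrees with `U` off the link `e` and MINIMISES the link-local action
  `S_e = ∑_{p ∋ e} (N − Re tr ρ(U_p))` over the `e`-fibre (relational: every exact tie-breaking rule is covered);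
  `IsCoolingStep.wilsonAction_sub_eq` (`S_W(U) − S_W(U') = S_e(U) − S_e(U')`), **`IsCoolingStep.wilsonAction_le`**;
  `exists_isCoolingStep` (compactness; continuous `ρ`).
* `IsCoolingSchedule ρ l U W` — `W` is reached by cooling the links of the list `l` in order (any sweep order, any
  number of sweeps); **`IsCoolingSchedule.wilsonAction_le`** (`S_W(W) ≤ S_W(U)` for EVERY schedule), `append`,
  `wilsonAction_le_of_continue` (more sweeps never increase the action), `exists_isCoolingSchedule`,
  `wilsonAction_nonneg_of_continuous` (the non-increasing action sequence is bounded below by `0`).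

§2 `SU(2)`, `2 × 2` matrix algebra over `IsQuat` (no lattice):
* `re_trace_le_two` / `eq_one_of_re_trace_eq_two` (`Re tr W ≤ 2` on `SU(2)`, equality only at `1`);
  **`re_trace_mul_le`**: `Re tr (g R) ≤ 2 √det R` for `g ∈ SU(2)` and any quaternion `R` — i.e. the link action
  `S_e = 4(d−1) − Re tr (U_e R_e)` is `≥ 4(d−1) − 2√det R_e` on the whole fibre;
* `coolMat R = Rᴴ/√det R`: `coolMat_mem` (`∈ SU(2)` for `R ≠ 0`), `coolMat_mul_self` (`coolMat R · R = √det R · 1`),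
  **`re_trace_coolMat_mul`** (the bound is attained) and **`eq_coolMat_of_re_trace_eq`** (ONLY there): the cooled
  `SU(2)` link is the unique minimiser of the link action — every exact implementation computes the same link from
  the same staples, so two cooling codes can differ only through the ORDER in which links are visited.

NOT CLAIMED: the lattice-level `SU(2)` cooling map and its fixed points (sequel `Scoring/SU2CoolingMap`: cooling-stable
configurations are Wilson-flow stationary); that different orders give different cooled fields (they do — D1); rates
of decrease, the number of sweeps to reach a plateau, or integrality of the cooled charge; `SU(N ≥ 3)` (no closed-form
minimiser; Cabibbo–Marinari subgroup cooling); any number.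
-/

noncomputable section

open Matrix
open Literature.MathematicalPhysics.QuantumFieldTheory
open Literature.MathematicalPhysics.QuantumLattice (fundamentalRep fundamentalRep_apply continuous_fundamentalRep)
open Summit.Ventures.LatticeQCDFlow.TrivializingMaps (linkAction wilsonAction_sub_linkAction_fibre continuous_linkAction)
open Summit.Ventures.LatticeQCDFlow.Exactness (IsQuat)

namespace Summit.Ventures.LatticeQCDFlow.Scoring

/-! ## §1 Cooling steps and schedules for any compact gauge group: the Wilson action never increases -/

section General

variable {d L N : ℕ} [NeZero L] {G : Type*} [Group G] [TopologicalSpace G] [IsTopologicalGroup G]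
  [CompactSpace G] (ρ : G →* Matrix (Fin N) (Fin N) ℂ)

/-- **A cooling step at the link `e`** takes `U` to `U'`: the two configurations agree off `e`, and the new
link MINIMISES the link-local Wilson action `S_e = ∑_{p ∋ e} (N − Re tr ρ(U_p))` over the whole `e`-fibre
`{h ·_e U}`.  (Relational on purpose: any tie-breaking rule of any implementation is covered.) -/
def IsCoolingStep (e : Edge d L) (U U' : GaugeConfig d L G) : Prop :=
  (∀ e', e' ≠ e → U' e' = U e') ∧ ∀ h : G, linkAction ρ e U' ≤ linkAction ρ e (Pi.mulSingle e h * U)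

omit [NeZero L] [TopologicalSpace G] [IsTopologicalGroup G] [CompactSpace G] in
/-- Updating one link is a move along its fibre: `update U e g = (g U_e⁻¹) ·_e U`. -/
theorem update_eq_mulSingle_mul (U : GaugeConfig d L G) (e : Edge d L) (g : G) :
    Function.update U e g = Pi.mulSingle e (g * (U e)⁻¹) * U := by
  ext e'
  by_cases he : e' = e
  · subst he
    rw [Function.update_self, Pi.mul_apply, Pi.mulSingle_eq_same, inv_mul_cancel_right]
  · rw [Function.update_of_ne he, Pi.mul_apply, Pi.mulSingle_eq_of_ne he, one_mul]

omit [NeZero L] [TopologicalSpace G] [IsTopologicalGroup G] [CompactSpace G] in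
/-- A configuration that agrees with `U` off `e` lies on the `e`-fibre of `U`. -/
theorem eq_mulSingle_mul_of_eq_off {e : Edge d L} {U U' : GaugeConfig d L G} (h : ∀ e', e' ≠ e → U' e' = U e') :
    U' = Pi.mulSingle e (U' e * (U e)⁻¹) * U := by
  rw [← update_eq_mulSingle_mul]
  ext e'
  by_cases he : e' = e
  · subst he; rw [Function.update_self]
  · rw [Function.update_of_ne he, h e' he]

namespace IsCoolingStep

variable {ρ} {e : Edge d L} {U U' : GaugeConfig d L G}

omit [TopologicalSpace G] [IsTopologicalGroup G] [CompactSpace G] in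
/-- Only the cooled link moves. -/
theorem eq_off (hc : IsCoolingStep ρ e U U') {e' : Edge d L} (he : e' ≠ e) : U' e' = U e' := hc.1 e' he

omit [TopologicalSpace G] [IsTopologicalGroup G] [CompactSpace G] in
/-- The cooled link minimises the link action along the fibre. -/
theorem le_fibre (hc : IsCoolingStep ρ e U U') (h : G) : linkAction ρ e U' ≤ linkAction ρ e (Pi.mulSingle e h * U) :=
  hc.2 h

omit [TopologicalSpace G] [IsTopologicalGroup G] [CompactSpace G] in
/-- The cooled configuration lies on the fibre of the cooled link. -/
theorem eq_mulSingle (hc : IsCoolingStep ρ e U U') : U' = Pi.mulSingle e (U' e * (U e)⁻¹) * U :=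
  eq_mulSingle_mul_of_eq_off hc.1

omit [TopologicalSpace G] [IsTopologicalGroup G] [CompactSpace G] in
/-- A cooling step does not increase the link action: `S_e(U') ≤ S_e(U)`. -/
theorem linkAction_le (hc : IsCoolingStep ρ e U U') : linkAction ρ e U' ≤ linkAction ρ e U := by
  simpa only [Pi.mulSingle_one, one_mul] using hc.le_fibre 1

omit [TopologicalSpace G] [IsTopologicalGroup G] [CompactSpace G] in
/-- **The Wilson action changes by exactly the change of the link action**: `S_W(U) − S_W(U') = S_e(U) − S_e(U')`
(the plaquettes not containing `e` do not move, `WilsonLinkLocality.wilsonAction_sub_linkAction_fibre`). -/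
theorem wilsonAction_sub_eq (hc : IsCoolingStep ρ e U U') :
    wilsonAction ρ U - wilsonAction ρ U' = linkAction ρ e U - linkAction ρ e U' := by
  have h := wilsonAction_sub_linkAction_fibre ρ e (U' e * (U e)⁻¹) U
  rw [← hc.eq_mulSingle] at h
  linarith

omit [TopologicalSpace G] [IsTopologicalGroup G] [CompactSpace G] in
/-- **A cooling step never increases the Wilson action.** -/
theorem wilsonAction_le (hc : IsCoolingStep ρ e U U') : wilsonAction ρ U' ≤ wilsonAction ρ U := by
  have h := hc.wilsonAction_sub_eq
  have h' := hc.linkAction_le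
  linarith

end IsCoolingStep

/-- **Cooling steps exist** at every link of every configuration (compact `G`, continuous `ρ`: the continuous
link action attains its minimum on the compact fibre). -/
theorem exists_isCoolingStep (hρ : Continuous ρ) (e : Edge d L) (U : GaugeConfig d L G) :
    ∃ U', IsCoolingStep ρ e U U' := by
  have hms : Continuous fun h : G => (Pi.mulSingle e h : GaugeConfig d L G) :=
    continuous_mulSingle (A := fun _ : Edge d L => G) e
  have hcont : Continuous fun h : G => linkAction ρ e (Pi.mulSingle e h * U) :=
    (continuous_linkAction ρ hρ e).comp (hms.mul continuous_const)
  obtain ⟨h₀, -, hmin⟩ := isCompact_univ.exists_isMinOn Set.univ_nonempty hcont.continuousOn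
  rw [isMinOn_univ_iff] at hmin
  -- (the witness is given first and the definition unfolded before splitting: elaborating the anonymous
  -- constructor directly against the folded `IsCoolingStep ρ e U (h₀ ·_e U)` is pathologically slow)
  refine ⟨Pi.mulSingle e h₀ * U, ?_⟩
  unfold IsCoolingStep
  exact ⟨fun e' he' => mulSingle_mul_apply_of_ne U he' h₀, hmin⟩

/-- **A cooling schedule**: `IsCoolingSchedule ρ l U W` says that `W` is reached from `U` by cooling the links of
the list `l` one after the other (head first) — a sweep in any visiting order, several sweeps, or any partial
schedule. -/
def IsCoolingSchedule : List (Edge d L) → GaugeConfig d L G → GaugeConfig d L G → Prop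
  | [], U, W => W = U
  | e :: l, U, W => ∃ V, IsCoolingStep ρ e U V ∧ IsCoolingSchedule l V W

omit [TopologicalSpace G] [IsTopologicalGroup G] [CompactSpace G] in
/-- Unfolding the empty schedule. -/
@[simp] theorem isCoolingSchedule_nil (U W : GaugeConfig d L G) : IsCoolingSchedule ρ [] U W ↔ W = U := Iff.rfl

omit [TopologicalSpace G] [IsTopologicalGroup G] [CompactSpace G] in
/-- Unfolding one step of a schedule. -/
@[simp] theorem isCoolingSchedule_cons (e : Edge d L) (l : List (Edge d L)) (U W : GaugeConfig d L G) :
    IsCoolingSchedule ρ (e :: l) U W ↔ ∃ V, IsCoolingStep ρ e U V ∧ IsCoolingSchedule ρ l V W := Iff.rfl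

namespace IsCoolingSchedule

variable {ρ}

omit [TopologicalSpace G] [IsTopologicalGroup G] [CompactSpace G] in
/-- **The Wilson action is non-increasing along EVERY cooling schedule** (every visiting order, every number
of sweeps, every exact tie-breaking rule). -/
theorem wilsonAction_le {l : List (Edge d L)} {U W : GaugeConfig d L G} (h : IsCoolingSchedule ρ l U W) :
    wilsonAction ρ W ≤ wilsonAction ρ U := by
  induction l generalizing U with
  | nil => rw [(isCoolingSchedule_nil ρ U W).mp h]
  | cons e l ih =>
    obtain ⟨V, hstep, hrest⟩ := h
    exact (ih hrest).trans hstep.wilsonAction_le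

omit [TopologicalSpace G] [IsTopologicalGroup G] [CompactSpace G] in
/-- Schedules compose: running `l₁` then `l₂` is running `l₁ ++ l₂`. -/
theorem append {l₁ l₂ : List (Edge d L)} {U V W : GaugeConfig d L G} (h₁ : IsCoolingSchedule ρ l₁ U V)
    (h₂ : IsCoolingSchedule ρ l₂ V W) : IsCoolingSchedule ρ (l₁ ++ l₂) U W := by
  induction l₁ generalizing U with
  | nil =>
    rw [(isCoolingSchedule_nil ρ U V).mp h₁] at h₂
    exact h₂
  | cons e l ih =>
    obtain ⟨V', hstep, hrest⟩ := h₁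
    exact ⟨V', hstep, ih hrest⟩

omit [TopologicalSpace G] [IsTopologicalGroup G] [CompactSpace G] in
/-- **More sweeps never hurt**: if `W₁` is the result of the schedule `l₁` and `W₂` of continuing with `l₂`, then
`S_W(W₂) ≤ S_W(W₁) ≤ S_W(U)` — the actions after `n = 0, 1, 2, …` sweeps form a non-increasing sequence, for every
sweep order. -/
theorem wilsonAction_le_of_continue {l₁ l₂ : List (Edge d L)} {U W₁ W₂ : GaugeConfig d L G}
    (h₁ : IsCoolingSchedule ρ l₁ U W₁) (h₂ : IsCoolingSchedule ρ l₂ W₁ W₂) :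
    wilsonAction ρ W₂ ≤ wilsonAction ρ W₁ ∧ wilsonAction ρ W₁ ≤ wilsonAction ρ U :=
  ⟨h₂.wilsonAction_le, h₁.wilsonAction_le⟩

end IsCoolingSchedule

/-- Every schedule can be run from every configuration (compact `G`, continuous `ρ`). -/
theorem exists_isCoolingSchedule (hρ : Continuous ρ) (l : List (Edge d L)) (U : GaugeConfig d L G) :
    ∃ W, IsCoolingSchedule ρ l U W := by
  induction l generalizing U with
  | nil => exact ⟨U, rfl⟩
  | cons e l ih =>
    obtain ⟨V, hV⟩ := exists_isCoolingStep ρ hρ e U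
    obtain ⟨W, hW⟩ := ih V
    exact ⟨W, V, hV, hW⟩

/-- The Wilson action is bounded below by `0`, so the non-increasing sequence of actions along any infinite
cooling run converges (stated here as the lower bound; `WilsonLinkLocality.linkAction_nonneg` per link). -/
theorem wilsonAction_nonneg_of_continuous (hρ : Continuous ρ) (U : GaugeConfig d L G) : 0 ≤ wilsonAction ρ U := by
  unfold wilsonAction
  refine Finset.sum_nonneg fun p _ => sub_nonneg.mpr ?_
  have h := Literature.RepresentationTheory.CompactGroups.CompactGroup.abs_re_trace_le_card ρ hρ
    (plaquetteHolonomy U p.1 p.2.1.1 p.2.1.2)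
  rw [Fintype.card_fin] at h
  exact (le_abs_self _).trans h

end General

/-! ## §2 `SU(2)`: `Re tr (g R) ≤ 2 √det R` on `SU(2)` for a quaternion `R`, with equality exactly at `g = Rᴴ/√det R` -/

section SU2Algebra

open Summit.Ventures.LatticeQCDFlow.Exactness.IsQuat (normSq)

variable {g R W : Matrix (Fin 2) (Fin 2) ℂ}

/-- `Re tr W ≤ 2` for `W ∈ SU(2)` (entries of a unitary matrix have modulus `≤ 1`). -/
theorem re_trace_le_two (hW : W ∈ Matrix.specialUnitaryGroup (Fin 2) ℂ) : W.trace.re ≤ 2 := by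
  have h := entry_norm_bound_of_unitary (Matrix.mem_specialUnitaryGroup_iff.mp hW).1
  rw [Matrix.trace_fin_two, Complex.add_re]
  have h0 := (Complex.re_le_norm (W 0 0)).trans (h 0 0)
  have h1 := (Complex.re_le_norm (W 1 1)).trans (h 1 1)
  linarith

/-- … with equality only at the identity: `Re tr W = 2`, `W ∈ SU(2)` force `W = 1`. -/
theorem eq_one_of_re_trace_eq_two (hW : W ∈ Matrix.specialUnitaryGroup (Fin 2) ℂ) (h : W.trace.re = 2) : W = 1 := by
  have hq := IsQuat.of_mem_specialUnitaryGroup hW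
  have hn : Complex.normSq (W 0 0) + Complex.normSq (W 0 1) = 1 := by
    have hdet := (Matrix.mem_specialUnitaryGroup_iff.mp hW).2
    rw [hq.det_eq] at hdet
    exact_mod_cast hdet
  have ha : (W 0 0).re = 1 := by
    rw [Matrix.trace_fin_two, hq.diag, Complex.add_re, Complex.conj_re] at h
    linarith
  rw [Complex.normSq_apply, Complex.normSq_apply, ha] at hn
  have him : (W 0 0).im = 0 := by nlinarith [sq_nonneg (W 0 0).im, sq_nonneg (W 0 1).re, sq_nonneg (W 0 1).im]
  have hbr : (W 0 1).re = 0 := by nlinarith [sq_nonneg (W 0 0).im, sq_nonneg (W 0 1).re, sq_nonneg (W 0 1).im]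
  have hbi : (W 0 1).im = 0 := by nlinarith [sq_nonneg (W 0 0).im, sq_nonneg (W 0 1).re, sq_nonneg (W 0 1).im]
  have h00 : W 0 0 = 1 := Complex.ext (by rw [ha, Complex.one_re]) (by rw [him, Complex.one_im])
  have h01 : W 0 1 = 0 := Complex.ext (by rw [hbr, Complex.zero_re]) (by rw [hbi, Complex.zero_im])
  ext i j
  fin_cases i <;> fin_cases j
  · simpa using h00
  · simpa using h01
  · simp [hq.offdiag, h01]
  · simp [hq.diag, h00]

/-- The norm `√(|a|² + |b|²) = √det R` of a quaternion `R = k • s` (`k ≥ 0`, `s ∈ SU(2)`) is `k`. -/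
theorem sqrt_normSq_eq_of_eq_smul (hR : IsQuat R) {k : ℝ} (hk : 0 ≤ k) {s : Matrix (Fin 2) (Fin 2) ℂ}
    (hs : s ∈ Matrix.specialUnitaryGroup (Fin 2) ℂ) (h : R = (k : ℂ) • s) : √(normSq R) = k := by
  have hdet : R.det = (k : ℂ) ^ 2 := by
    rw [h, Matrix.det_smul, (Matrix.mem_specialUnitaryGroup_iff.mp hs).2, mul_one, Fintype.card_fin]
  rw [hR.det_eq] at hdet
  have hk2 : normSq R = k ^ 2 := by exact_mod_cast hdet
  rw [hk2, Real.sqrt_sq hk]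

/-- **`Re tr (g R) ≤ 2 √det R`** for `g ∈ SU(2)` and any quaternion `R` (write `R = k ŝ`, `ŝ ∈ SU(2)`; then
`Re tr (g R) = k Re tr (g ŝ) ≤ 2k`).  For the link action `S_e = 4(d−1) − Re tr (U_e R_e)` this is the lower bound
`S_e ≥ 4(d−1) − 2√det R_e` along the fibre. -/
theorem re_trace_mul_le (hg : g ∈ Matrix.specialUnitaryGroup (Fin 2) ℂ) (hR : IsQuat R) :
    (g * R).trace.re ≤ 2 * √(normSq R) := by
  obtain ⟨k, hk, s, hs, hRks⟩ := hR.exists_eq_smul_specialUnitary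
  rw [sqrt_normSq_eq_of_eq_smul hR hk hs hRks, hRks, Matrix.mul_smul, Matrix.trace_smul, smul_eq_mul,
    Complex.re_ofReal_mul]
  have h2 := re_trace_le_two (Submonoid.mul_mem _ hg hs)
  nlinarith

/-- **The cooled link matrix** for a staple sum `R`: `coolMat R = Rᴴ / √det R` (for a non-zero quaternion `R`;
at `R = 0` the value is the junk `0` and is never used). -/
def coolMat (R : Matrix (Fin 2) (Fin 2) ℂ) : Matrix (Fin 2) (Fin 2) ℂ :=
  (((√(normSq R))⁻¹ : ℝ) : ℂ) • Rᴴ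

/-- Unfolding lemma for `coolMat`. -/
theorem coolMat_def (R : Matrix (Fin 2) (Fin 2) ℂ) : coolMat R = (((√(normSq R))⁻¹ : ℝ) : ℂ) • Rᴴ := rfl

/-- In the polar form `R = k ŝ` (`k > 0`): `coolMat R = ŝᴴ`. -/
theorem coolMat_eq_of_eq_smul (hR : IsQuat R) {k : ℝ} (hk : 0 < k) {s : Matrix (Fin 2) (Fin 2) ℂ}
    (hs : s ∈ Matrix.specialUnitaryGroup (Fin 2) ℂ) (h : R = (k : ℂ) • s) : coolMat R = sᴴ := by
  rw [coolMat, sqrt_normSq_eq_of_eq_smul hR hk.le hs h, h, Matrix.conjTranspose_smul, Complex.star_def,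
    Complex.conj_ofReal, smul_smul, ← Complex.ofReal_mul, inv_mul_cancel₀ hk.ne', Complex.ofReal_one, one_smul]

/-- `coolMat R ∈ SU(2)` for every non-zero quaternion `R`. -/
theorem coolMat_mem (hR : IsQuat R) (h0 : R ≠ 0) : coolMat R ∈ Matrix.specialUnitaryGroup (Fin 2) ℂ := by
  obtain ⟨k, hk, s, hs, hRks⟩ := hR.exists_eq_smul_specialUnitary
  have hk0 : 0 < k := by
    rcases hk.lt_or_eq with hlt | heq
    · exact hlt
    · exfalso; apply h0; rw [hRks, ← heq, Complex.ofReal_zero, zero_smul]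
  rw [coolMat_eq_of_eq_smul hR hk0 hs hRks]
  exact (star (⟨s, hs⟩ : Matrix.specialUnitaryGroup (Fin 2) ℂ)).2

/-- **The cooled link attains the bound**: `Re tr (coolMat R · R) = 2 √det R`; indeed `coolMat R · R = √det R · 1`. -/
theorem coolMat_mul_self (hR : IsQuat R) (h0 : R ≠ 0) :
    coolMat R * R = ((√(normSq R) : ℝ) : ℂ) • (1 : Matrix (Fin 2) (Fin 2) ℂ) := by
  obtain ⟨k, hk, s, hs, hRks⟩ := hR.exists_eq_smul_specialUnitary
  have hk0 : 0 < k := by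
    rcases hk.lt_or_eq with hlt | heq
    · exact hlt
    · exfalso; apply h0; rw [hRks, ← heq, Complex.ofReal_zero, zero_smul]
  have hss : sᴴ * s = 1 := by
    rw [← Matrix.star_eq_conjTranspose]
    exact Matrix.mem_unitaryGroup_iff'.mp (Matrix.mem_specialUnitaryGroup_iff.mp hs).1
  rw [coolMat_eq_of_eq_smul hR hk0 hs hRks, sqrt_normSq_eq_of_eq_smul hR hk hs hRks, hRks, Matrix.mul_smul,
    hss]

/-- `Re tr (coolMat R · R) = 2 √det R`. -/
theorem re_trace_coolMat_mul (hR : IsQuat R) (h0 : R ≠ 0) : (coolMat R * R).trace.re = 2 * √(normSq R) := by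
  rw [coolMat_mul_self hR h0, Matrix.trace_smul, Matrix.trace_one, Fintype.card_fin, smul_eq_mul,
    Complex.re_ofReal_mul]
  norm_num
  ring

/-- **Uniqueness of the minimiser**: if `g ∈ SU(2)` attains `Re tr (g R) = 2 √det R` for a non-zero quaternion
`R`, then `g = coolMat R = Rᴴ/√det R`. -/
theorem eq_coolMat_of_re_trace_eq (hg : g ∈ Matrix.specialUnitaryGroup (Fin 2) ℂ) (hR : IsQuat R) (h0 : R ≠ 0)
    (h : (g * R).trace.re = 2 * √(normSq R)) : g = coolMat R := by
  obtain ⟨k, hk, s, hs, hRks⟩ := hR.exists_eq_smul_specialUnitary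
  have hk0 : 0 < k := by
    rcases hk.lt_or_eq with hlt | heq
    · exact hlt
    · exfalso; apply h0; rw [hRks, ← heq, Complex.ofReal_zero, zero_smul]
  rw [sqrt_normSq_eq_of_eq_smul hR hk hs hRks, hRks, Matrix.mul_smul, Matrix.trace_smul, smul_eq_mul,
    Complex.re_ofReal_mul] at h
  have h2 : (g * s).trace.re = 2 := by
    have := mul_left_cancel₀ hk0.ne' (h.trans (mul_comm 2 k))
    exact this
  have hgs : g * s = 1 := eq_one_of_re_trace_eq_two (Submonoid.mul_mem _ hg hs) h2
  have hss : s * sᴴ = 1 := by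
    rw [← Matrix.star_eq_conjTranspose]
    exact Matrix.mem_unitaryGroup_iff.mp (Matrix.mem_specialUnitaryGroup_iff.mp hs).1
  rw [coolMat_eq_of_eq_smul hR hk0 hs hRks]
  calc g = g * (s * sᴴ) := by rw [hss, mul_one]
    _ = sᴴ := by rw [← mul_assoc, hgs, one_mul]

end SU2Algebra

end Summit.Ventures.LatticeQCDFlow.Scoring
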